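import Mathlib.Analysis.InnerProductSpace.PiL2
import Mathlib.Analysis.InnerProductSpace.Projection.FiniteDimensional
import Mathlib.Topology.MetricSpace.Basic
import Literature.Geometry.DiscreteGeometry.KissingPatterns
import Literature.MathematicalPhysics.StatisticalMechanics.BarlowStacking
import HarnessLib
import Summits.AtomisticToContinuum.Crystallization.Theorems.HullExactificationCascadeRobustBarlowTemplateDefs

/-!
# Stub `stub_reciprocity` for line `registered`
(crux `RobustBarlowTemplate`, stmt-AtomisticToContinuum-12088)

Statement (`stub_reciprocity`): in a `δ`-separated configuration `S ⊆ ℝ³` all of whose points are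
`1/20`-good (the rescaled, recentred first shell is `1/20`-matched, after a linear isometry, to
the FCC or the HCP kissing pattern), the shell relation is symmetric with comparable scales:
`z ∈ shell S y → y ∈ shell S z ∧ 9/10 · d(y) ≤ d(z) ≤ 10/9 · d(y)` (robust Hales §1.3, first
movement).

Proof outline.
* `recip_nnd_le`, `recip_le_nnd`: the nearest-neighbour distance `d(y) = nnd S y` is a conditional
  infimum: `d(y) ≤ dist t y` for `t ∈ S ∖ {y}` and `δ ≤ d(y)`.
* `recip_cover`: COVERING — for every linear-isometric copy of either pattern and every `u` there
  is a pattern point `p` with `⟪u, A p⟫ ≥ ‖u‖ / 2` (a `60°` cap around any direction contains a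
  pattern point); by an explicit sorted-coordinates case analysis on integer models.
* `recip_shell_approx`, `recip_shell_sep`: a good shell point `t` satisfies
  `t - y = d • A p + ε`, `‖ε‖ ≤ d/20`, hence `dist t y ≤ 21/20 · d`, and distinct shell points are
  `≥ 9/10 · d` apart.
* `stub_reciprocity`: if `y ∉ shell S z` then `13/10 · d(z) ≤ r := dist y z`; the covering gives a
  shell point `w` of `z` roughly in the direction of `y`, which lands in `shell S y` at distance
  `< 9/10 · d(y)` from `z ∈ shell S y`, contradicting the separation of `shell S y`. The scale
  comparison then follows from `d(z) ≤ dist y z ≤ 21/20 · d(y)` and symmetrically.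
-/

noncomputable section

namespace Summit.AtomisticToContinuum.Crystallization.Theorems.HullExactificationCascadeRobustBarlowTemplate

open Literature.MathematicalPhysics.StatisticalMechanics Literature.Geometry.DiscreteGeometry
open RealInnerProductSpace

/-- Euclidean `3`-space. -/
local notation "E3" => EuclideanSpace ℝ (Fin 3)

/-! ### Nearest-neighbour distance -/

/-- `d(y) ≤ dist t y` for every other point `t` of `S` (the defining infimum is over a set of
distances, bounded below by `0`). -/
theorem recip_nnd_le {S : Set E3} {y t : E3} (ht : t ∈ S) (hty : t ≠ y) : nnd S y ≤ dist t y :=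
  csInf_le ⟨0, by rintro r ⟨z, -, rfl⟩; exact dist_nonneg⟩ ⟨t, ⟨ht, hty⟩, rfl⟩

/-- In a `δ`-separated set, `δ ≤ d(y)` as soon as `y` is not the only point. -/
theorem recip_le_nnd {δ : ℝ} {S : Set E3} (hS : Sep δ S) {y : E3} (hy : y ∈ S)
    (hne : (S \ {y}).Nonempty) : δ ≤ nnd S y := by
  refine le_csInf (hne.image _) ?_
  rintro r ⟨t, ⟨ht, hty⟩, rfl⟩
  exact hS t ht y hy hty

/-! ### Covering: a `60°` cap around any direction contains a pattern point -/

/-- Leaf of the covering argument: an integer vector `w = (m₀, m₁, m₂) ∈ T` with real coordinates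
`(a, b, c)`, `0 ≤ L := a v₀ + b v₁ + c v₂` and `N ‖v‖² ≤ 4 L²` yields the point `w/√N` of the
scaled pattern with `‖v‖ / 2 ≤ ⟪v, w/√N⟫`. -/
theorem recip_cover_leaf {T : Finset (Fin 3 → ℤ)} {N : ℕ} (hN : N ≠ 0) (v : E3) (m₀ m₁ m₂ : ℤ)
    (hw : ![m₀, m₁, m₂] ∈ T) (a b c : ℝ) (habc : (m₀ : ℝ) = a ∧ (m₁ : ℝ) = b ∧ (m₂ : ℝ) = c)
    (hL : 0 ≤ a * v 0 + b * v 1 + c * v 2)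
    (hsq : (N : ℝ) * (v 0 ^ 2 + v 1 ^ 2 + v 2 ^ 2) ≤ 4 * (a * v 0 + b * v 1 + c * v 2) ^ 2) :
    ∃ p ∈ scaledPattern T N, ‖v‖ / 2 ≤ ⟪v, p⟫ := by
  obtain ⟨ha, hb, hc⟩ := habc
  refine ⟨(Real.sqrt N)⁻¹ • intVec ![m₀, m₁, m₂], Finset.mem_image_of_mem _ hw, ?_⟩
  have hNpos : (0 : ℝ) < N := by exact_mod_cast Nat.pos_of_ne_zero hN
  have hsN : 0 < Real.sqrt N := Real.sqrt_pos.2 hNpos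
  have hinner : ⟪v, (Real.sqrt N)⁻¹ • intVec ![m₀, m₁, m₂]⟫ =
      (Real.sqrt N)⁻¹ * (a * v 0 + b * v 1 + c * v 2) := by
    rw [real_inner_smul_right, ← ha, ← hb, ← hc]
    congr 1
    simp only [PiLp.inner_apply, RCLike.inner_apply, conj_trivial, Fin.sum_univ_three,
      intVec_apply, Matrix.cons_val_zero, Matrix.cons_val_one, Matrix.cons_val_two,
      Matrix.head_cons, Matrix.tail_cons]
  have hnorm : ‖v‖ ^ 2 = v 0 ^ 2 + v 1 ^ 2 + v 2 ^ 2 := by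
    rw [EuclideanSpace.real_norm_sq_eq, Fin.sum_univ_three]
  have key : Real.sqrt N * ‖v‖ ≤ 2 * (a * v 0 + b * v 1 + c * v 2) := by
    refine le_of_pow_le_pow_left₀ two_ne_zero (by linarith) ?_
    rw [mul_pow, Real.sq_sqrt hNpos.le, hnorm]
    nlinarith [hsq]
  rw [hinner, div_le_iff₀ (by norm_num : (0 : ℝ) < 2)]
  calc ‖v‖ = (Real.sqrt N)⁻¹ * (Real.sqrt N * ‖v‖) := by field_simp
    _ ≤ (Real.sqrt N)⁻¹ * (2 * (a * v 0 + b * v 1 + c * v 2)) :=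
      mul_le_mul_of_nonneg_left key (inv_nonneg.2 hsN.le)
    _ = (Real.sqrt N)⁻¹ * (a * v 0 + b * v 1 + c * v 2) * 2 := by ring

/-- FCC leaf: `w ∈ fccInt` with `0 ≤ L` and `‖v‖² ≤ 2 L²`. -/
theorem recip_leaf_fcc (v : E3) (m₀ m₁ m₂ : ℤ) (hw : ![m₀, m₁, m₂] ∈ fccInt) (a b c : ℝ)
    (habc : (m₀ : ℝ) = a ∧ (m₁ : ℝ) = b ∧ (m₂ : ℝ) = c)
    (hL : 0 ≤ a * v 0 + b * v 1 + c * v 2)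
    (hsq : 2 * (v 0 ^ 2 + v 1 ^ 2 + v 2 ^ 2) ≤ 4 * (a * v 0 + b * v 1 + c * v 2) ^ 2) :
    ∃ p ∈ fccKissingPattern, ‖v‖ / 2 ≤ ⟪v, p⟫ :=
  recip_cover_leaf two_ne_zero v m₀ m₁ m₂ hw a b c habc hL (by simpa using hsq)

/-- HCP leaf: `w ∈ hcpInt` with `0 ≤ L` and `18 ‖v‖² ≤ 4 L²`. -/
theorem recip_leaf_hcp (v : E3) (m₀ m₁ m₂ : ℤ) (hw : ![m₀, m₁, m₂] ∈ hcpInt) (a b c : ℝ)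
    (habc : (m₀ : ℝ) = a ∧ (m₁ : ℝ) = b ∧ (m₂ : ℝ) = c)
    (hL : 0 ≤ a * v 0 + b * v 1 + c * v 2)
    (hsq : 18 * (v 0 ^ 2 + v 1 ^ 2 + v 2 ^ 2) ≤ 4 * (a * v 0 + b * v 1 + c * v 2) ^ 2) :
    ∃ p ∈ hcpKissingPattern, ‖v‖ / 2 ≤ ⟪v, p⟫ :=
  recip_cover_leaf (by norm_num) v m₀ m₁ m₂ hw a b c habc hL (by simpa using hsq)

/-- Arithmetic core of the covering, on sorted reals `a ≤ b ≤ c` (think `a = v i`, `b = v j`,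
`c = v k`): the three sign cases `0 ≤ a` (use `e_j + e_k`), `a ≤ 0 ≤ c` (use `e_k - e_i`),
`c ≤ 0` (use `-e_i - e_j` for FCC and `-(1,1,1) - 3 e_i` for HCP). -/
theorem recip_cover_sorted (a b c : ℝ) (hab : a ≤ b) (hbc : b ≤ c) :
    (0 ≤ a → 0 ≤ b + c ∧ 9 * (a ^ 2 + b ^ 2 + c ^ 2) ≤ 18 * (b + c) ^ 2) ∧
    (a ≤ 0 → 0 ≤ c → 0 ≤ c - a ∧ 9 * (a ^ 2 + b ^ 2 + c ^ 2) ≤ 18 * (c - a) ^ 2) ∧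
    (c ≤ 0 → 0 ≤ -a - b ∧ 9 * (a ^ 2 + b ^ 2 + c ^ 2) ≤ 18 * (-a - b) ^ 2 ∧
      0 ≤ -4 * a - b - c ∧ 18 * (a ^ 2 + b ^ 2 + c ^ 2) ≤ 4 * (-4 * a - b - c) ^ 2) := by
  refine ⟨fun ha => ⟨by linarith, ?_⟩, fun ha hc => ⟨by linarith, ?_⟩,
    fun hc => ⟨by linarith, ?_, by linarith, ?_⟩⟩
  · nlinarith [mul_nonneg (sub_nonneg.2 hab) (by linarith : 0 ≤ a + b),
      mul_nonneg (ha.trans hab) (ha.trans (hab.trans hbc))]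
  · nlinarith [sq_le_sq' (by linarith : -(c - a) ≤ b) (by linarith : b ≤ c - a),
      mul_nonneg (neg_nonneg.2 ha) hc]
  · nlinarith [mul_nonneg (sub_nonneg.2 hbc) (by linarith : 0 ≤ -c - b),
      mul_nonneg (neg_nonneg.2 (hab.trans (hbc.trans hc))) (neg_nonneg.2 (hbc.trans hc))]
  · nlinarith [mul_nonneg (sub_nonneg.2 hab) (by linarith : 0 ≤ -b - a),
      mul_nonneg (sub_nonneg.2 (hab.trans hbc)) (by linarith : 0 ≤ -c - a),
      mul_nonneg (by linarith : 0 ≤ -b - c) (by linarith : 0 ≤ -8 * a - b - c)]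

/-- COVERING for both patterns: every `v` has an FCC point and an HCP point `p` with
`‖v‖ / 2 ≤ ⟪v, p⟫` (six orderings of the coordinates, three sign cases each). -/
theorem recip_cover (v : E3) :
    (∃ p ∈ fccKissingPattern, ‖v‖ / 2 ≤ ⟪v, p⟫) ∧
      (∃ p ∈ hcpKissingPattern, ‖v‖ / 2 ≤ ⟪v, p⟫) := by
  rcases le_total (v 0) (v 1) with h01 | h10
  · rcases le_total (v 1) (v 2) with h12 | h21
    · -- v 0 ≤ v 1 ≤ v 2
      obtain ⟨hA, hC, hB⟩ := recip_cover_sorted (v 0) (v 1) (v 2) h01 h12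
      rcases le_total 0 (v 0) with hs | hs
      · obtain ⟨h1, h2⟩ := hA hs
        exact ⟨recip_leaf_fcc v 0 1 1 (by decide) 0 1 1 (by norm_num) (by linarith)
          (by linarith), recip_leaf_hcp v 0 3 3 (by decide) 0 3 3 (by norm_num)
          (by linarith) (by linarith)⟩
      rcases le_total 0 (v 2) with hs' | hs'
      · obtain ⟨h1, h2⟩ := hC hs hs'
        exact ⟨recip_leaf_fcc v (-1) 0 1 (by decide) (-1) 0 1 (by norm_num) (by linarith)
          (by linarith), recip_leaf_hcp v (-3) 0 3 (by decide) (-3) 0 3 (by norm_num)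
          (by linarith) (by linarith)⟩
      · obtain ⟨h1, h2, h3, h4⟩ := hB hs'
        exact ⟨recip_leaf_fcc v (-1) (-1) 0 (by decide) (-1) (-1) 0 (by norm_num) (by linarith)
          (by linarith), recip_leaf_hcp v (-4) (-1) (-1) (by decide) (-4) (-1) (-1) (by norm_num)
          (by linarith) (by linarith)⟩
    · rcases le_total (v 0) (v 2) with h02 | h20
      · -- v 0 ≤ v 2 ≤ v 1
        obtain ⟨hA, hC, hB⟩ := recip_cover_sorted (v 0) (v 2) (v 1) h02 h21
        rcases le_total 0 (v 0) with hs | hs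
        · obtain ⟨h1, h2⟩ := hA hs
          exact ⟨recip_leaf_fcc v 0 1 1 (by decide) 0 1 1 (by norm_num) (by linarith)
            (by linarith), recip_leaf_hcp v 0 3 3 (by decide) 0 3 3 (by norm_num)
            (by linarith) (by linarith)⟩
        rcases le_total 0 (v 1) with hs' | hs'
        · obtain ⟨h1, h2⟩ := hC hs hs'
          exact ⟨recip_leaf_fcc v (-1) 1 0 (by decide) (-1) 1 0 (by norm_num) (by linarith)
            (by linarith), recip_leaf_hcp v (-3) 3 0 (by decide) (-3) 3 0 (by norm_num)
            (by linarith) (by linarith)⟩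
        · obtain ⟨h1, h2, h3, h4⟩ := hB hs'
          exact ⟨recip_leaf_fcc v (-1) 0 (-1) (by decide) (-1) 0 (-1) (by norm_num)
            (by linarith) (by linarith), recip_leaf_hcp v (-4) (-1) (-1) (by decide) (-4) (-1) (-1)
            (by norm_num) (by linarith) (by linarith)⟩
      · -- v 2 ≤ v 0 ≤ v 1
        obtain ⟨hA, hC, hB⟩ := recip_cover_sorted (v 2) (v 0) (v 1) h20 h01
        rcases le_total 0 (v 2) with hs | hs
        · obtain ⟨h1, h2⟩ := hA hs
          exact ⟨recip_leaf_fcc v 1 1 0 (by decide) 1 1 0 (by norm_num) (by linarith)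
            (by linarith), recip_leaf_hcp v 3 3 0 (by decide) 3 3 0 (by norm_num)
            (by linarith) (by linarith)⟩
        rcases le_total 0 (v 1) with hs' | hs'
        · obtain ⟨h1, h2⟩ := hC hs hs'
          exact ⟨recip_leaf_fcc v 0 1 (-1) (by decide) 0 1 (-1) (by norm_num) (by linarith)
            (by linarith), recip_leaf_hcp v 0 3 (-3) (by decide) 0 3 (-3) (by norm_num)
            (by linarith) (by linarith)⟩
        · obtain ⟨h1, h2, h3, h4⟩ := hB hs'
          exact ⟨recip_leaf_fcc v (-1) 0 (-1) (by decide) (-1) 0 (-1) (by norm_num)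
            (by linarith) (by linarith), recip_leaf_hcp v (-1) (-1) (-4) (by decide) (-1) (-1) (-4)
            (by norm_num) (by linarith) (by linarith)⟩
  · rcases le_total (v 0) (v 2) with h02 | h20
    · -- v 1 ≤ v 0 ≤ v 2
      obtain ⟨hA, hC, hB⟩ := recip_cover_sorted (v 1) (v 0) (v 2) h10 h02
      rcases le_total 0 (v 1) with hs | hs
      · obtain ⟨h1, h2⟩ := hA hs
        exact ⟨recip_leaf_fcc v 1 0 1 (by decide) 1 0 1 (by norm_num) (by linarith)
          (by linarith), recip_leaf_hcp v 3 0 3 (by decide) 3 0 3 (by norm_num)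
          (by linarith) (by linarith)⟩
      rcases le_total 0 (v 2) with hs' | hs'
      · obtain ⟨h1, h2⟩ := hC hs hs'
        exact ⟨recip_leaf_fcc v 0 (-1) 1 (by decide) 0 (-1) 1 (by norm_num) (by linarith)
          (by linarith), recip_leaf_hcp v 0 (-3) 3 (by decide) 0 (-3) 3 (by norm_num)
          (by linarith) (by linarith)⟩
      · obtain ⟨h1, h2, h3, h4⟩ := hB hs'
        exact ⟨recip_leaf_fcc v (-1) (-1) 0 (by decide) (-1) (-1) 0 (by norm_num) (by linarith)
          (by linarith), recip_leaf_hcp v (-1) (-4) (-1) (by decide) (-1) (-4) (-1) (by norm_num)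
          (by linarith) (by linarith)⟩
    · rcases le_total (v 1) (v 2) with h12 | h21
      · -- v 1 ≤ v 2 ≤ v 0
        obtain ⟨hA, hC, hB⟩ := recip_cover_sorted (v 1) (v 2) (v 0) h12 h20
        rcases le_total 0 (v 1) with hs | hs
        · obtain ⟨h1, h2⟩ := hA hs
          exact ⟨recip_leaf_fcc v 1 0 1 (by decide) 1 0 1 (by norm_num) (by linarith)
            (by linarith), recip_leaf_hcp v 3 0 3 (by decide) 3 0 3 (by norm_num)
            (by linarith) (by linarith)⟩
        rcases le_total 0 (v 0) with hs' | hs'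
        · obtain ⟨h1, h2⟩ := hC hs hs'
          exact ⟨recip_leaf_fcc v 1 (-1) 0 (by decide) 1 (-1) 0 (by norm_num) (by linarith)
            (by linarith), recip_leaf_hcp v 3 (-3) 0 (by decide) 3 (-3) 0 (by norm_num)
            (by linarith) (by linarith)⟩
        · obtain ⟨h1, h2, h3, h4⟩ := hB hs'
          exact ⟨recip_leaf_fcc v 0 (-1) (-1) (by decide) 0 (-1) (-1) (by norm_num)
            (by linarith) (by linarith), recip_leaf_hcp v (-1) (-4) (-1) (by decide) (-1) (-4) (-1)
            (by norm_num) (by linarith) (by linarith)⟩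
      · -- v 2 ≤ v 1 ≤ v 0
        obtain ⟨hA, hC, hB⟩ := recip_cover_sorted (v 2) (v 1) (v 0) h21 h10
        rcases le_total 0 (v 2) with hs | hs
        · obtain ⟨h1, h2⟩ := hA hs
          exact ⟨recip_leaf_fcc v 1 1 0 (by decide) 1 1 0 (by norm_num) (by linarith)
            (by linarith), recip_leaf_hcp v 3 3 0 (by decide) 3 3 0 (by norm_num)
            (by linarith) (by linarith)⟩
        rcases le_total 0 (v 0) with hs' | hs'
        · obtain ⟨h1, h2⟩ := hC hs hs'
          exact ⟨recip_leaf_fcc v 1 0 (-1) (by decide) 1 0 (-1) (by norm_num) (by linarith)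
            (by linarith), recip_leaf_hcp v 3 0 (-3) (by decide) 3 0 (-3) (by norm_num)
            (by linarith) (by linarith)⟩
        · obtain ⟨h1, h2, h3, h4⟩ := hB hs'
          exact ⟨recip_leaf_fcc v 0 (-1) (-1) (by decide) 0 (-1) (-1) (by norm_num)
            (by linarith) (by linarith), recip_leaf_hcp v (-1) (-1) (-4) (by decide) (-1) (-1) (-4)
            (by norm_num) (by linarith) (by linarith)⟩

/-- The covering transported by a linear isometry `A` of `ℝ³` (which is onto, by finite
dimension): every `u` has `p ∈ P` with `‖u‖ / 2 ≤ ⟪u, A p⟫`. -/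
theorem recip_cover_iso {P : Finset E3} (hP : ∀ v : E3, ∃ p ∈ P, ‖v‖ / 2 ≤ ⟪v, p⟫)
    (A : E3 →ₗᵢ[ℝ] E3) (u : E3) : ∃ p ∈ P, ‖u‖ / 2 ≤ ⟪u, A p⟫ := by
  have hsurj : Function.Surjective A.toLinearMap :=
    LinearMap.surjective_of_injective A.injective
  obtain ⟨v, rfl⟩ := hsurj u
  obtain ⟨p, hp, h⟩ := hP v
  refine ⟨p, hp, ?_⟩
  rw [LinearIsometry.coe_toLinearMap, LinearIsometry.inner_map_map, LinearIsometry.norm_map]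
  exact h

/-! ### Good points: pattern data and shell geometry -/

/-- Unpacking `Good S y` uniformly over the two patterns: a finite pattern `P` of unit vectors
with pairwise distances `≥ 1` and the covering property, a linear isometry `A` and the
`1/20`-matching `e`. -/
theorem recip_good_data {S : Set E3} {y : E3} (h : Good S y) :
    ∃ (P : Finset E3) (A : E3 →ₗᵢ[ℝ] E3) (e : ↥(shell S y) ≃ ↥P),
      (∀ p ∈ P, ‖p‖ = 1) ∧ (∀ p ∈ P, ∀ q ∈ P, p ≠ q → 1 ≤ dist p q) ∧
      (∀ v : E3, ∃ p ∈ P, ‖v‖ / 2 ≤ ⟪v, A p⟫) ∧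
      ∀ t : ↥(shell S y), dist ((nnd S y)⁻¹ • ((t : E3) - y)) (A (e t : E3)) ≤ 1 / 20 := by
  obtain ⟨A, ⟨e, he⟩ | ⟨e, he⟩⟩ := h
  · exact ⟨fccKissingPattern, A, e, fun p hp => norm_eq_one_of_mem_fccKissingPattern hp,
      fun p hp q hq hpq => one_le_dist_of_mem_fccKissingPattern hp hq hpq,
      recip_cover_iso (fun v => (recip_cover v).1) A, he⟩
  · exact ⟨hcpKissingPattern, A, e, fun p hp => norm_eq_one_of_mem_hcpKissingPattern hp,
      fun p hp q hq hpq => one_le_dist_of_mem_hcpKissingPattern hp hq hpq,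
      recip_cover_iso (fun v => (recip_cover v).2) A, he⟩

/-- In a separated set, a good point has `0 < d(y)` (its shell, in bijection with a nonempty
pattern, is nonempty, so `y` is not alone and `δ ≤ d(y)`). -/
theorem recip_nnd_pos {δ : ℝ} {S : Set E3} (hδ : 0 < δ) (hS : Sep δ S) {y : E3} (hy : y ∈ S)
    {P : Finset E3} {A : E3 →ₗᵢ[ℝ] E3} (e : ↥(shell S y) ≃ ↥P)
    (hP3 : ∀ v : E3, ∃ p ∈ P, ‖v‖ / 2 ≤ ⟪v, A p⟫) : 0 < nnd S y := by
  obtain ⟨p, hp, -⟩ := hP3 0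
  have ht := (e.symm ⟨p, hp⟩).2
  exact lt_of_lt_of_le hδ (recip_le_nnd hS hy ⟨_, ht.1, ht.2.1⟩)

/-- Shell geometry of a good point: for `t ∈ shell S y`, `t - y = d • A p + ε` with
`‖ε‖ ≤ d / 20`, `‖A p‖ = 1`, hence `dist t y ≤ 21/20 · d`. -/
theorem recip_shell_approx {S : Set E3} {y : E3} {P : Finset E3} {A : E3 →ₗᵢ[ℝ] E3}
    {e : ↥(shell S y) ≃ ↥P} (hP1 : ∀ p ∈ P, ‖p‖ = 1)
    (he : ∀ t : ↥(shell S y), dist ((nnd S y)⁻¹ • ((t : E3) - y)) (A (e t : E3)) ≤ 1 / 20)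
    (hd : 0 < nnd S y) (t : ↥(shell S y)) :
    ‖((t : E3) - y) - nnd S y • A (e t : E3)‖ ≤ nnd S y / 20 ∧ ‖A (e t : E3)‖ = 1 ∧
      dist (t : E3) y ≤ 21 / 20 * nnd S y := by
  have hAp : ‖A (e t : E3)‖ = 1 := by rw [LinearIsometry.norm_map]; exact hP1 _ (e t).2
  have h1 : ‖((t : E3) - y) - nnd S y • A (e t : E3)‖ ≤ nnd S y / 20 := by
    have h := he t
    rw [dist_eq_norm] at h
    have hfac : ((t : E3) - y) - nnd S y • A (e t : E3) =
        nnd S y • ((nnd S y)⁻¹ • ((t : E3) - y) - A (e t : E3)) := by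
      rw [smul_sub, smul_inv_smul₀ hd.ne']
    rw [hfac, norm_smul, Real.norm_of_nonneg hd.le]
    calc nnd S y * ‖(nnd S y)⁻¹ • ((t : E3) - y) - A (e t : E3)‖
        ≤ nnd S y * (1 / 20) := mul_le_mul_of_nonneg_left h hd.le
      _ = nnd S y / 20 := by ring
  refine ⟨h1, hAp, ?_⟩
  have h2 : ‖(t : E3) - y‖ - ‖nnd S y • A (e t : E3)‖ ≤
      ‖((t : E3) - y) - nnd S y • A (e t : E3)‖ := norm_sub_norm_le _ _
  rw [norm_smul, Real.norm_of_nonneg hd.le, hAp, mul_one] at h2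
  rw [dist_eq_norm]
  linarith

/-- Distinct points of the shell of a good point are `≥ 9/10 · d` apart (their pattern images
are distinct unit vectors at distance `≥ 1`, and each point is `d/20`-close to `y + d •` its
image). -/
theorem recip_shell_sep {S : Set E3} {y : E3} {P : Finset E3} {A : E3 →ₗᵢ[ℝ] E3}
    {e : ↥(shell S y) ≃ ↥P} (hP1 : ∀ p ∈ P, ‖p‖ = 1)
    (hP2 : ∀ p ∈ P, ∀ q ∈ P, p ≠ q → 1 ≤ dist p q)
    (he : ∀ t : ↥(shell S y), dist ((nnd S y)⁻¹ • ((t : E3) - y)) (A (e t : E3)) ≤ 1 / 20)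
    (hd : 0 < nnd S y) (t t' : ↥(shell S y)) (htt' : t ≠ t') :
    9 / 10 * nnd S y ≤ dist (t : E3) t' := by
  obtain ⟨hε, -, -⟩ := recip_shell_approx hP1 he hd t
  obtain ⟨hε', -, -⟩ := recip_shell_approx hP1 he hd t'
  have hne : (e t : E3) ≠ (e t' : E3) := fun h => htt' (e.injective (Subtype.ext h))
  have hpp : 1 ≤ ‖A (e t : E3) - A (e t' : E3)‖ := by
    rw [← dist_eq_norm, LinearIsometry.dist_map]
    exact hP2 _ (e t).2 _ (e t').2 hne
  have hX : (t : E3) - t' - (((t : E3) - y - nnd S y • A (e t : E3)) -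
      ((t' : E3) - y - nnd S y • A (e t' : E3))) =
      nnd S y • (A (e t : E3) - A (e t' : E3)) := by
    rw [smul_sub]; abel
  have h3 := norm_sub_le ((t : E3) - t')
    (((t : E3) - y - nnd S y • A (e t : E3)) - ((t' : E3) - y - nnd S y • A (e t' : E3)))
  rw [hX, norm_smul, Real.norm_of_nonneg hd.le] at h3
  have h4 := norm_sub_le ((t : E3) - y - nnd S y • A (e t : E3))
    ((t' : E3) - y - nnd S y • A (e t' : E3))
  have h5 : nnd S y * 1 ≤ nnd S y * ‖A (e t : E3) - A (e t' : E3)‖ :=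
    mul_le_mul_of_nonneg_left hpp hd.le
  rw [dist_eq_norm]
  linarith

/-! ### The stub -/

/-- STUB `stub_reciprocity` (registered on stmt-AtomisticToContinuum-12088, line `registered`):
reciprocity of shells in an everywhere-good separated configuration — if `z ∈ shell S y` then
`y ∈ shell S z` and `9/10 · d(y) ≤ d(z) ≤ 10/9 · d(y)`. -/
theorem stub_reciprocity :
    ∀ δ : ℝ, 0 < δ → ∀ S : Set E3, Sep δ S → (∀ y ∈ S, Good S y) → Recip S := by
  intro δ hδ S hSep hGood y hy z hz
  have hzS : z ∈ S := hz.1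
  have hzy : z ≠ y := hz.2.1
  obtain ⟨P, A, e, hP1, hP2, hP3, he⟩ := recip_good_data (hGood y hy)
  obtain ⟨P', A', e', hP1', hP2', hP3', he'⟩ := recip_good_data (hGood z hzS)
  have hdy : 0 < nnd S y := recip_nnd_pos hδ hSep hy e hP3
  have hdz : 0 < nnd S z := recip_nnd_pos hδ hSep hzS e' hP3'
  have hyz_le : dist y z ≤ 21 / 20 * nnd S y := by
    rw [dist_comm]; exact (recip_shell_approx hP1 he hdy ⟨z, hz⟩).2.2
  have hdy_le : nnd S y ≤ dist y z := by rw [dist_comm]; exact recip_nnd_le hzS hzy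
  have hdz_le : nnd S z ≤ dist y z := recip_nnd_le hy (fun h => hzy h.symm)
  -- symmetry of the shell relation
  have hyz_lt : dist y z < 13 / 10 * nnd S z := by
    by_contra hcon
    have hr : 13 / 10 * nnd S z ≤ dist y z := not_lt.1 hcon
    obtain ⟨p, hp, hcov⟩ := hP3' (y - z)
    have happ := recip_shell_approx hP1' he' hdz (e'.symm ⟨p, hp⟩)
    rw [Equiv.apply_symm_apply] at happ
    obtain ⟨hε, -, hwz⟩ := happ
    have hwsh : ((e'.symm ⟨p, hp⟩ : ↥(shell S z)) : E3) ∈ shell S z := (e'.symm ⟨p, hp⟩).2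
    set w : E3 := ((e'.symm ⟨p, hp⟩ : ↥(shell S z)) : E3) with hw
    have hε' : ‖(w - z) - nnd S z • A' p‖ ≤ nnd S z / 20 := hε
    have hr' : 13 / 10 * nnd S z ≤ ‖y - z‖ := by rwa [dist_eq_norm] at hr
    have hwz' : ‖w - z‖ ≤ 21 / 20 * nnd S z := by rwa [dist_eq_norm] at hwz
    -- the shell point `w` of `z` in the direction of `y` is closer to `y` than `z` is
    have hin : nnd S z * (‖y - z‖ / 2) - ‖y - z‖ * (nnd S z / 20) ≤ ⟪y - z, w - z⟫ := by
      have h1 : ⟪y - z, w - z⟫ =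
          nnd S z * ⟪y - z, A' p⟫ + ⟪y - z, (w - z) - nnd S z • A' p⟫ := by
        rw [← real_inner_smul_right, ← inner_add_right, add_sub_cancel]
      have h2 := (abs_le.1 (abs_real_inner_le_norm (y - z) ((w - z) - nnd S z • A' p))).1
      have h3 : nnd S z * (‖y - z‖ / 2) ≤ nnd S z * ⟪y - z, A' p⟫ :=
        mul_le_mul_of_nonneg_left hcov hdz.le
      have h4 : ‖y - z‖ * ‖(w - z) - nnd S z • A' p‖ ≤ ‖y - z‖ * (nnd S z / 20) :=
        mul_le_mul_of_nonneg_left hε' (norm_nonneg _)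
      linarith
    have hlt : ‖w - y‖ < ‖y - z‖ := by
      refine lt_of_pow_lt_pow_left₀ 2 (norm_nonneg _) ?_
      have hexp : ‖w - y‖ ^ 2 = ‖w - z‖ ^ 2 - 2 * ⟪w - z, y - z⟫ + ‖y - z‖ ^ 2 := by
        rw [← norm_sub_sq_real, sub_sub_sub_cancel_right]
      have hsq1 : ‖w - z‖ ^ 2 ≤ (21 / 20 * nnd S z) ^ 2 :=
        pow_le_pow_left₀ (norm_nonneg _) hwz' 2
      have hrpos : 0 < ‖y - z‖ := lt_of_lt_of_le (by linarith) hr'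
      rw [hexp, real_inner_comm]
      nlinarith [mul_le_mul_of_nonneg_left hr' hdz.le, mul_pos hdz hrpos]
    have hwy_lt : dist w y < dist y z := by rwa [dist_eq_norm, dist_eq_norm]
    have hw_ne_y : w ≠ y := by
      intro h
      rw [h] at hwz
      linarith
    have hwy : w ∈ shell S y := ⟨hwsh.1, hw_ne_y, by linarith⟩
    have hsep : 9 / 10 * nnd S y ≤ dist w z :=
      recip_shell_sep hP1 hP2 he hdy ⟨w, hwy⟩ ⟨z, hz⟩
        (fun h => hwsh.2.1 (congrArg Subtype.val h))
    linarith
  have hysz : y ∈ shell S z := ⟨hy, fun h => hzy h.symm, hyz_lt⟩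
  have hzy_le' : dist y z ≤ 21 / 20 * nnd S z := (recip_shell_approx hP1' he' hdz ⟨y, hysz⟩).2.2
  refine ⟨hysz, ?_, ?_⟩
  · linarith
  · linarith

end Summit.AtomisticToContinuum.Crystallization.Theorems.HullExactificationCascadeRobustBarlowTemplate

end
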